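import Literature.NumberTheory.EllipticCurves.Fouquet2025.CongruenceTransportFromSeedMainIdentity
import Literature.NumberTheory.EllipticCurves.PAdicBSDInterpolationProofs
import Literature.NumberTheory.EllipticCurves.PAdicLFunctionProofs
import HarnessLib

/-!
# Fouquet 2025, Thm 4.1 (1) ⇒ (2) via a unit-value seed — the turnkey rank-0 road of
# `CongruenceTransportFromSeedMainIdentity.lean` in CENSUS currency, and the same road for the MAIN
# IDENTITY of a good-ordinary target (fact (B′)) (theorems only)

Topic `NumberTheory/EllipticCurves`, sub-directory `Fouquet2025`. Typer seat `bsd-littype-07` (gen 2),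
cross-ladder literature-typing layer (D-0088(4)). Companion (THEOREMS ONLY, no named fact, no
definition, no instance, no notation, no `sorry`) of `CongruenceTransportFromSeedMainIdentity.lean`
(facts (A′)/(B′) and the road `padicValRat_bsd_rank_zero_of_congruence_of_unitSeed`, whose partner
hypothesis is `‖L_p(g, α_G)(0)‖ = 1`). Here that hypothesis is discharged from what a census
computes: at a good ordinary prime `p` of the partner `G` with newform `g`,
`L_p(g, α)(0) = (1 − α⁻¹)² · [0]⁺_g` (Mazur–Tate–Teitelbaum 1986 §I.14 (14.3) at the trivial character;
tree theorem `constantCoeff_padicLFunction_unitRoot`), `[0]⁺_g = ratPlusSymbol g 0 = L(G,1)/Ω⁺_g`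
(Birch), and `‖1 − α⁻¹‖ = 1` iff `p ∤ a_p(G) − 1` (the unit root `α ≡ a_p (mod p)`,
`unitRoot_spec_holds`). So the road needs: `p ∤ a_p(G) − 1`, `[0]⁺_g ≠ 0`, `v_p([0]⁺_g) = 0` — and
bsd.S20 (Kato Thm 17.4) for `G` plus the fact (A′). For the Néron-normalised census value
`L(G,1)/Ω_G` the period ratio `Ω_G/Ω⁺_g` is a `p`-adic unit when `G[p]` is irreducible (tree fact
`realPeriodRat_eq_unit_mul_plusPeriod`, Greenberg–Vatsal 2000 (3.3)); not restated here.
References: [Fouquet2025EquivariantTNC] Thm 4.1, proof of Cor. 4.3 (p. 26), §4.2.2 (pp. 29–30);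
[Kato2004Asterisque] Thm 17.4 (p. 273); [MazurTateTeitelbaum1986Invent] §I.11, §I.14 (14.3).
-/

noncomputable section

open scoped Classical MatrixGroups ModularForm

namespace Literature.NumberTheory.EllipticCurves.Fouquet2025

open WeierstrassCurve CongruenceSubgroup Literature.NumberTheory.EllipticCurves.ModularForms

/-! ## The unit criterion in special-VALUE currency (what a census computes): `‖L_p(G,0)‖ = 1`
## from `p ∤ a_p(G) − 1` and `v_p([0]⁺_g) = 0`, `[0]⁺_g = L(G,1)/Ω⁺_g` -/

/-- **Non-anomalous unit root.** At a good ordinary prime `p` of `G`, if `p ∤ a_p(G) − 1` then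
`‖1 − α⁻¹‖ = 1` for the unit root `α = unitRoot G p` (`α² − a_pα + p = 0`, `α ∈ ℤ_pˣ`, tree theorem
`unitRoot_spec_holds`): `α(α − a_p) = −p` gives `‖α − a_p‖ = p⁻¹ < 1 = ‖a_p − 1‖`, so
`‖α − 1‖ = ‖(a_p − 1) + (α − a_p)‖ = 1`, and `1 − α⁻¹ = α⁻¹(α − 1)` with `‖α⁻¹‖ = 1`.
[cite: MazurTateTeitelbaum1986Invent, §I.11 (allowable root) and §I.14 (the p-adic multiplier)] -/
theorem norm_one_sub_inv_unitRoot_eq_one (G : WeierstrassCurve ℚ) [G.IsGloballyMinimal] (p : ℕ)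
    [Fact p.Prime] (hord : IsOrdinaryAt G p) (hap : ¬ (p : ℤ) ∣ G.frobeniusTrace p - 1) :
    ‖1 - (unitRoot G p : ℚ_[p])⁻¹‖ = 1 := by
  have hp : (p : ℝ)⁻¹ < 1 := inv_lt_one_of_one_lt₀ (by exact_mod_cast (Fact.out : p.Prime).one_lt)
  obtain ⟨hα, hu⟩ := unitRoot_spec_holds G p hord
  set α : ℤ_[p] := unitRoot G p with hαdef
  have hnα : ‖α‖ = 1 := PadicInt.isUnit_iff.mp hu
  -- `‖α − a_p‖ = p⁻¹`
  have hprod : α * (α - (G.frobeniusTrace p : ℤ_[p])) = -(p : ℤ_[p]) := by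
    linear_combination hα
  have hsub : ‖α - (G.frobeniusTrace p : ℤ_[p])‖ = (p : ℝ)⁻¹ := by
    have h := congrArg (‖·‖) hprod
    simp only [norm_mul, hnα, one_mul, norm_neg, PadicInt.norm_p] at h
    exact h
  -- `‖a_p − 1‖ = 1`
  have hone : ‖((G.frobeniusTrace p - 1 : ℤ) : ℤ_[p])‖ = 1 := by
    refine le_antisymm (PadicInt.norm_le_one _) ?_
    by_contra hlt
    exact hap ((PadicInt.norm_int_lt_one_iff_dvd _).mp (not_le.mp hlt))
  -- `‖α − 1‖ = 1`
  have hα1 : ‖α - 1‖ = 1 := by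
    have heq : α - 1 = ((G.frobeniusTrace p - 1 : ℤ) : ℤ_[p]) + (α - (G.frobeniusTrace p : ℤ_[p])) := by
      push_cast; ring
    have hne : ‖((G.frobeniusTrace p - 1 : ℤ) : ℤ_[p])‖ ≠ ‖α - (G.frobeniusTrace p : ℤ_[p])‖ := by
      rw [hone, hsub]; exact (ne_of_lt hp).symm
    rw [heq, PadicInt.norm_add_eq_max_of_ne hne, hone, hsub]
    exact max_eq_left hp.le
  -- pass to `ℚ_p`
  have hα0 : (α : ℚ_[p]) ≠ 0 := by
    intro h0
    have : ‖(α : ℚ_[p])‖ = 1 := by rw [PadicInt.padic_norm_e_of_padicInt, hnα]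
    rw [h0, norm_zero] at this
    exact zero_ne_one this
  have hrew : 1 - (α : ℚ_[p])⁻¹ = (α : ℚ_[p])⁻¹ * ((α - 1 : ℤ_[p]) : ℚ_[p]) := by
    push_cast
    field_simp
  rw [hrew, norm_mul, norm_inv, PadicInt.padic_norm_e_of_padicInt, PadicInt.padic_norm_e_of_padicInt,
    hnα, hα1, inv_one, one_mul]

/-- **`‖L_p(G,0)‖ = 1` from census data.** At a good ordinary prime `p` of `G` with newform `g`:
if `p ∤ a_p(G) − 1` (non-anomalous) and the rational plus symbol `[0]⁺_g = L(G,1)/Ω⁺_g`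
(`ratPlusSymbol g 0`) is non-zero of `p`-adic valuation `0`, then the constant term
`L_p(g, α)(0) = (1 − α⁻¹)²·[0]⁺_g` (Mazur–Tate–Teitelbaum (14.3) at the trivial character; tree theorem
`constantCoeff_padicLFunction_unitRoot`) has `p`-adic norm `1`. (For the Néron-normalised value
`L(G,1)/Ω_G` of a census use the period-ratio fact `realPeriodRat_eq_unit_mul_plusPeriod` of the tree:
`Ω_G/Ω⁺_g` is a `p`-adic unit when `G[p]` is irreducible.) [cite: MazurTateTeitelbaum1986Invent, §I.14 (14.3)] -/
theorem norm_constantCoeff_padicLFunction_eq_one_of_padicValRat_eq_zero (G : WeierstrassCurve ℚ)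
    [G.IsElliptic] [G.IsGloballyMinimal] (p : ℕ) [Fact p.Prime] (hord : IsOrdinaryAt G p)
    {N : ℕ} [NeZero N] (g : CuspForm (Gamma0 N) 2) (hg : IsNewformOf G g)
    (hap : ¬ (p : ℤ) ∣ G.frobeniusTrace p - 1)
    (hL0 : ratPlusSymbol g 0 ≠ 0) (hval : padicValRat p (ratPlusSymbol g 0) = 0) :
    ‖PowerSeries.constantCoeff (padicLFunction g (unitRoot G p : ℚ_[p]))‖ = 1 := by
  rw [constantCoeff_padicLFunction_unitRoot hord hg, norm_mul, norm_pow,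
    norm_one_sub_inv_unitRoot_eq_one G p hord hap, one_pow, one_mul, Padic.eq_padicNorm,
    padicNorm.eq_zpow_of_nonzero hL0, hval, neg_zero, zpow_zero, Rat.cast_one]

/-- **The turnkey rank-0 road in census currency.** As `padicValRat_bsd_rank_zero_of_congruence_of_unitSeed`,
with the unit-`L_p` hypothesis on the good-ordinary partner `G` replaced by: `p ∤ a_p(G) − 1`,
`[0]⁺_g = L(G,1)/Ω⁺_g ≠ 0` and `v_p([0]⁺_g) = 0`. Inputs granted: (A′) and Kato's bsd.S20 for `G`;
everything else is kernel-checked. [cite: Fouquet2025EquivariantTNC, Thm 4.1 (1)⇒(2) (pp. 24–25), proof of Cor. 4.3 first half (p. 26), §4.2.2 (pp. 29–30)] [cite: Kato2004Asterisque, Thm 17.4 (3) (p. 273)] [cite: MazurTateTeitelbaum1986Invent, §I.14 (14.3)] -/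
theorem padicValRat_bsd_rank_zero_of_congruence_of_unitValueSeed
    (hA : padicValRat_bsd_rank_zero_of_congruence_of_seedMainIdentity)
    (W G : WeierstrassCurve ℚ) [W.IsElliptic] [W.IsGloballyMinimal] [G.IsElliptic] [G.IsGloballyMinimal]
    (p : ℕ) [Fact p.Prime] (hp : 5 ≤ p)
    (hKato : ∀ (κ : ZpExtension ℚ p) (γ : Field.absoluteGaloisGroup ℚ) (N : ℕ) [NeZero N]
      (g : CuspForm (Gamma0 N) 2), kato_divisibility G p (κ := κ) (γ := γ) (f := g))
    (hsurj : W.HasSurjectiveModNGaloisRep p)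
    (hΨ : ∀ x : ℚ_[p], ((W.baseChange ℚ_[p]).ΨSq (p : ℤ)).eval x ≠ 0)
    (h34 : Assumption34TateAt p W)
    (hGgood : G.HasGoodReductionAtPrime p) (hGord : ¬ (p : ℤ) ∣ G.frobeniusTrace p)
    (hGirr : G.HasIrreducibleModPGaloisRep p) (hGbig : ∀ n : ℕ, G.HasSurjectiveModNGaloisRep (p ^ n : ℕ))
    {M : ℕ} [NeZero M] (g : CuspForm (Gamma0 M) 2) (hg : IsNewformOf G g)
    (hap : ¬ (p : ℤ) ∣ G.frobeniusTrace p - 1)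
    (hL0 : ratPlusSymbol g 0 ≠ 0) (hval : padicValRat p (ratPlusSymbol g 0) = 0)
    (hcong : ∀ ℓ : ℕ, ℓ.Prime → ¬ (ℓ ∣ p * W.conductorNorm ℤ * G.conductorNorm ℤ) →
      ((W.LFunction ℓ : ℤ) : ZMod p) = ((G.LFunction ℓ : ℤ) : ZMod p))
    (hlev : ∀ q : ℕ, q.Prime → q ≠ p → (q : ℤ) ∣ G.conductorNorm ℤ → (q : ℤ) ∣ W.conductorNorm ℤ)
    (hL : W.entireLFunction 1 ≠ 0) (hsha : Finite W.sha) :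
    ∃ q : ℚ, W.entireLFunction 1 / (W.realPeriodRat : ℂ) = (q : ℂ) ∧
      padicValRat p q = (padicValNat p W.shaOrder : ℤ) + padicValNat p W.tamagawaProduct -
        2 * padicValNat p W.torsionOrder :=
  padicValRat_bsd_rank_zero_of_congruence_of_unitSeed hA W G p hp hKato hsurj hΨ h34 hGgood hGord hGirr
    hGbig g hg (norm_constantCoeff_padicLFunction_eq_one_of_padicValRat_eq_zero G p ⟨hGgood, hGord⟩ g
      hg hap hL0 hval) hcong hlev hL hsha

/-! ## The same unit-value partner road for the MAIN IDENTITY of a good-ordinary target (fact (B′)):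
## `char_Λ X(W/ℚ_∞) = (L_p(W,T))` for `W` WITHOUT a ramified Steinberg prime, in any rank -/

/-- **Turnkey main-identity road (B′) + bsd.S20 with a unit-`L_p` partner.** Granting the fact (B′)
`charIdeal_eq_padicLFunction_of_congruence_of_seedMainIdentity` and Kato's bsd.S20 for the partner `G`:
a target `W` good ordinary at `p ≥ 5` with `ρ̄_{W,p}` onto, `ρ_{W,p^n}` onto for all `n`, `ΨSq_p`
rootless over `ℚ_p` and `Assumption34TateAt p W`, congruent mod `p` off `p·N_W·N_G` to a good-ordinary
`G` (bad primes `≠ p` of `G` dividing `N_W`) with `G[p]` irreducible, `ρ_{G,p^n}` onto for all `n` and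
a newform `g` with `‖L_p(g, α_G)(0)‖ = 1`, satisfies the integral cyclotomic main identity
`Sakamoto2024.CyclotomicMainIdentityAt W p f` for every newform `f` of `W` — in ANY rank, with NO
ramified Steinberg prime on either curve (the Skinner–Urban hypothesis of bsd.S21 is traded for a
congruent unit-value partner; OPEN-QUESTIONS-07 F3 in hypothesis shape).
[cite: Fouquet2025EquivariantTNC, Thm 4.1 (1)⇒(2) (pp. 24–25), proof of Cor. 4.3 first half (p. 26), §4.2 (pp. 28–30)] [cite: Kato2004Asterisque, Thm 17.4 (3) (p. 273), §17.13 (pp. 279–280)] -/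
theorem cyclotomicMainIdentityAt_of_congruence_of_unitSeed
    (hB : charIdeal_eq_padicLFunction_of_congruence_of_seedMainIdentity)
    (W G : WeierstrassCurve ℚ) [W.IsElliptic] [W.IsGloballyMinimal] [G.IsElliptic] [G.IsGloballyMinimal]
    (p : ℕ) [Fact p.Prime] (hp : 5 ≤ p)
    (hKato : ∀ (κ : ZpExtension ℚ p) (γ : Field.absoluteGaloisGroup ℚ) (N : ℕ) [NeZero N]
      (g : CuspForm (Gamma0 N) 2), kato_divisibility G p (κ := κ) (γ := γ) (f := g))
    (hWgood : W.HasGoodReductionAtPrime p) (hWord : ¬ (p : ℤ) ∣ W.frobeniusTrace p)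
    (hsurj : W.HasSurjectiveModNGaloisRep p) (hWbig : ∀ n : ℕ, W.HasSurjectiveModNGaloisRep (p ^ n : ℕ))
    (hΨ : ∀ x : ℚ_[p], ((W.baseChange ℚ_[p]).ΨSq (p : ℤ)).eval x ≠ 0)
    (h34 : Assumption34TateAt p W)
    (hGgood : G.HasGoodReductionAtPrime p) (hGord : ¬ (p : ℤ) ∣ G.frobeniusTrace p)
    (hGirr : G.HasIrreducibleModPGaloisRep p) (hGbig : ∀ n : ℕ, G.HasSurjectiveModNGaloisRep (p ^ n : ℕ))
    {M : ℕ} [NeZero M] (g : CuspForm (Gamma0 M) 2) (hg : IsNewformOf G g)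
    (hunit : ‖PowerSeries.constantCoeff (padicLFunction g (unitRoot G p : ℚ_[p]))‖ = 1)
    (hcong : ∀ ℓ : ℕ, ℓ.Prime → ¬ (ℓ ∣ p * W.conductorNorm ℤ * G.conductorNorm ℤ) →
      ((W.LFunction ℓ : ℤ) : ZMod p) = ((G.LFunction ℓ : ℤ) : ZMod p))
    (hlev : ∀ q : ℕ, q.Prime → q ≠ p → (q : ℤ) ∣ G.conductorNorm ℤ → (q : ℤ) ∣ W.conductorNorm ℤ)
    {N : ℕ} [NeZero N] (f : CuspForm (Gamma0 N) 2) (hf : IsNewformOf W f) :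
    Sakamoto2024.CyclotomicMainIdentityAt W p f := by
  have hid : Sakamoto2024.CyclotomicMainIdentityAt G p g :=
    cyclotomicMainIdentityAt_of_katoDivisibility_of_norm_constantCoeff_eq_one G p hKato (by omega)
      ⟨hGgood, hGord⟩ hGbig g hg hunit
  exact hB W G p hp hWgood hWord hsurj hWbig hΨ h34 hGgood hGord hGirr hGbig g hg hid hcong hlev f hf

/-- **The same, in census currency:** the partner's unit hypothesis as `p ∤ a_p(G) − 1`,
`[0]⁺_g = L(G,1)/Ω⁺_g ≠ 0`, `v_p([0]⁺_g) = 0`.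
[cite: Fouquet2025EquivariantTNC, Thm 4.1 (1)⇒(2) (pp. 24–25), proof of Cor. 4.3 first half (p. 26)] [cite: Kato2004Asterisque, Thm 17.4 (3) (p. 273)] [cite: MazurTateTeitelbaum1986Invent, §I.14 (14.3)] -/
theorem cyclotomicMainIdentityAt_of_congruence_of_unitValueSeed
    (hB : charIdeal_eq_padicLFunction_of_congruence_of_seedMainIdentity)
    (W G : WeierstrassCurve ℚ) [W.IsElliptic] [W.IsGloballyMinimal] [G.IsElliptic] [G.IsGloballyMinimal]
    (p : ℕ) [Fact p.Prime] (hp : 5 ≤ p)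
    (hKato : ∀ (κ : ZpExtension ℚ p) (γ : Field.absoluteGaloisGroup ℚ) (N : ℕ) [NeZero N]
      (g : CuspForm (Gamma0 N) 2), kato_divisibility G p (κ := κ) (γ := γ) (f := g))
    (hWgood : W.HasGoodReductionAtPrime p) (hWord : ¬ (p : ℤ) ∣ W.frobeniusTrace p)
    (hsurj : W.HasSurjectiveModNGaloisRep p) (hWbig : ∀ n : ℕ, W.HasSurjectiveModNGaloisRep (p ^ n : ℕ))
    (hΨ : ∀ x : ℚ_[p], ((W.baseChange ℚ_[p]).ΨSq (p : ℤ)).eval x ≠ 0)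
    (h34 : Assumption34TateAt p W)
    (hGgood : G.HasGoodReductionAtPrime p) (hGord : ¬ (p : ℤ) ∣ G.frobeniusTrace p)
    (hGirr : G.HasIrreducibleModPGaloisRep p) (hGbig : ∀ n : ℕ, G.HasSurjectiveModNGaloisRep (p ^ n : ℕ))
    {M : ℕ} [NeZero M] (g : CuspForm (Gamma0 M) 2) (hg : IsNewformOf G g)
    (hap : ¬ (p : ℤ) ∣ G.frobeniusTrace p - 1)
    (hL0 : ratPlusSymbol g 0 ≠ 0) (hval : padicValRat p (ratPlusSymbol g 0) = 0)
    (hcong : ∀ ℓ : ℕ, ℓ.Prime → ¬ (ℓ ∣ p * W.conductorNorm ℤ * G.conductorNorm ℤ) →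
      ((W.LFunction ℓ : ℤ) : ZMod p) = ((G.LFunction ℓ : ℤ) : ZMod p))
    (hlev : ∀ q : ℕ, q.Prime → q ≠ p → (q : ℤ) ∣ G.conductorNorm ℤ → (q : ℤ) ∣ W.conductorNorm ℤ)
    {N : ℕ} [NeZero N] (f : CuspForm (Gamma0 N) 2) (hf : IsNewformOf W f) :
    Sakamoto2024.CyclotomicMainIdentityAt W p f :=
  cyclotomicMainIdentityAt_of_congruence_of_unitSeed hB W G p hp hKato hWgood hWord hsurj hWbig hΨ h34
    hGgood hGord hGirr hGbig g hg
    (norm_constantCoeff_padicLFunction_eq_one_of_padicValRat_eq_zero G p ⟨hGgood, hGord⟩ g hg hap hL0 hval)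
    hcong hlev f hf

end Literature.NumberTheory.EllipticCurves.Fouquet2025

end
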